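import Mathlib
import Summits.Ventures.PercRepro2.ThreeTermPinnedClosure
import Summits.Ventures.PercRepro2.ThreeTermPinnedAbstract

/-!
# Three-terminal parts, VI c: the state of a pinned core through its labeling
(blind cell PercRepro2, night-3 g31, 2026-08-30; `proofs/NIGHT3-CERT.md` §40.7)

Over the background `z₀` (every part edge closed) the six points `o b a₃ t₁ t₂ t₃` receive the LABELING
`labOf`: `0` in `a₁`'s cluster, `1` in `a₂`'s, `2 + w` in the neither-cluster whose least point is `w`.
When `a₁ ≁ a₂` in the background:

* `labOf v = 0 ↔ Conn z₀ a₁ (pt v)`, `labOf v = 1 ↔ Conn z₀ a₂ (pt v)`, `labOf v = labOf w ↔ Conn z₀ (pt v) (pt w)`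
  (`labOf_eq_zero_iff`, `labOf_eq_one_iff`, `labOf_eq_iff`); the labeling is bounded (`labOf_le`) and
  guarded (`guard_labOf`), i.e. one of the 3,263 canonical labelings of ThreeTermPinnedAbstract.lean;
* through `conn_pattern_iff` the connections of the pattern configuration `x = setOn S (cfg i) z` to the
  roots are the abstract ones (`conn_a1_iff`, `conn_a2_iff`, `conn_q_iff`), so the cell's STATE of `x` is
  the abstract state of the labeling: **`st_eq_stAbs`**.

Own work; standard axioms.
-/

namespace Summit.Ventures.PercRepro2

open Block ThreeTerm TypedStar CovForm CovForm.OneTyped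

namespace Part

section Least

/-- The least index satisfying a predicate on `Fin 6` (`5` if none). -/
def least6 (p : Fin 6 → Bool) : Fin 6 :=
  if p 0 then 0 else if p 1 then 1 else if p 2 then 2 else if p 3 then 3 else if p 4 then 4 else 5

/-- The least index satisfies the predicate when some index does. -/
lemma least6_spec (p : Fin 6 → Bool) (h : ∃ w, p w = true) : p (least6 p) = true := by
  obtain ⟨w, hw⟩ := h
  unfold least6
  split_ifs with h0 h1 h2 h3 h4
  · exact h0
  · exact h1
  · exact h2
  · exact h3
  · exact h4
  · fin_cases w <;> simp_all

/-- The least index is at most any index satisfying the predicate. -/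
lemma least6_min (p : Fin 6 → Bool) {w : Fin 6} (hw : p w = true) : least6 p ≤ w := by
  unfold least6
  split_ifs with h0 h1 h2 h3 h4
  · exact Fin.zero_le _
  · fin_cases w <;> simp_all
  · fin_cases w <;> simp_all
  · fin_cases w <;> simp_all
  · fin_cases w <;> simp_all
  · fin_cases w <;> simp_all

/-- Two predicates with the same extension have the same least index. -/
lemma least6_congr {p q : Fin 6 → Bool} (h : ∀ w, p w = q w) : least6 p = least6 q := by
  have : p = q := funext h
  rw [this]

end Least

section Labeling

open Classical

variable {V : Type*} {E : Type*} [DecidableEq E]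

/-- The six points. -/
def pt (o b a₃ t₁ t₂ t₃ : V) : Fin 6 → V := ![o, b, a₃, t₁, t₂, t₃]

/-- The terminals among the six points. -/
lemma pt_tidx (o b a₃ t₁ t₂ t₃ : V) (a : Fin 3) : pt o b a₃ t₁ t₂ t₃ (tidx a) = tv t₁ t₂ t₃ a := by
  fin_cases a <;> rfl

/-- **The labeling** of the six points by the background `z₀`. -/
noncomputable def labOf (G : E → Sym2 V) (z₀ : Config E) (a₁ a₂ : V) (p : Fin 6 → V) (v : Fin 6) : Fin 8 :=
  if Conn G z₀ a₁ (p v) then 0 else if Conn G z₀ a₂ (p v) then 1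
  else ⟨2 + (least6 fun w => decide (Conn G z₀ (p w) (p v))).val, by
    have := (least6 fun w => decide (Conn G z₀ (p w) (p v))).isLt; omega⟩

variable (G : E → Sym2 V) (z₀ : Config E) (a₁ a₂ : V) (p : Fin 6 → V)

omit [DecidableEq E] in
/-- The third branch of the labeling is at least `2`. -/
lemma labOf_ge_two {v : Fin 6} (h1 : ¬ Conn G z₀ a₁ (p v)) (h2 : ¬ Conn G z₀ a₂ (p v)) :
    2 ≤ (labOf G z₀ a₁ a₂ p v).val := by
  simp only [labOf, h1, h2, if_false]
  omega

omit [DecidableEq E] in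
/-- `labOf v = 0` iff `v` lies in `a₁`'s background cluster. -/
lemma labOf_eq_zero_iff (v : Fin 6) : labOf G z₀ a₁ a₂ p v = 0 ↔ Conn G z₀ a₁ (p v) := by
  by_cases h1 : Conn G z₀ a₁ (p v)
  · simp [labOf, h1]
  · by_cases h2 : Conn G z₀ a₂ (p v)
    · simp [labOf, h1, h2]
    · refine ⟨fun h => ?_, fun h => absurd h h1⟩
      have := labOf_ge_two G z₀ a₁ a₂ p h1 h2
      rw [h] at this
      exact absurd this (by decide)

omit [DecidableEq E] in
/-- `labOf v = 1` iff `v` lies in `a₂`'s background cluster (when `a₁ ≁ a₂`). -/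
lemma labOf_eq_one_iff (hQ : ¬ Conn G z₀ a₁ a₂) (v : Fin 6) :
    labOf G z₀ a₁ a₂ p v = 1 ↔ Conn G z₀ a₂ (p v) := by
  by_cases h1 : Conn G z₀ a₁ (p v)
  · have h2 : ¬ Conn G z₀ a₂ (p v) := fun h2 => hQ (conn_trans h1 (conn_symm h2))
    simp [labOf, h1, h2]
  · by_cases h2 : Conn G z₀ a₂ (p v)
    · simp [labOf, h1, h2]
    · refine ⟨fun h => ?_, fun h => absurd h h2⟩
      have := labOf_ge_two G z₀ a₁ a₂ p h1 h2
      rw [h] at this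
      exact absurd this (by decide)

omit [DecidableEq E] in
/-- The labeling in the neither branch. -/
lemma labOf_of_neither {v : Fin 6} (h1 : ¬ Conn G z₀ a₁ (p v)) (h2 : ¬ Conn G z₀ a₂ (p v)) :
    (labOf G z₀ a₁ a₂ p v).val = 2 + (least6 fun w => decide (Conn G z₀ (p w) (p v))).val := by
  simp [labOf, h1, h2]

omit [DecidableEq E] in
/-- **Equal labels are background connections** (when `a₁ ≁ a₂`). -/
lemma labOf_eq_iff (hQ : ¬ Conn G z₀ a₁ a₂) (v w : Fin 6) :
    labOf G z₀ a₁ a₂ p v = labOf G z₀ a₁ a₂ p w ↔ Conn G z₀ (p v) (p w) := by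
  constructor
  · intro h
    by_cases hv1 : Conn G z₀ a₁ (p v)
    · have hv0 : labOf G z₀ a₁ a₂ p v = 0 := (labOf_eq_zero_iff G z₀ a₁ a₂ p v).2 hv1
      rw [hv0] at h
      have hw1 := (labOf_eq_zero_iff G z₀ a₁ a₂ p w).1 h.symm
      exact conn_trans (conn_symm hv1) hw1
    by_cases hv2 : Conn G z₀ a₂ (p v)
    · have hv0 : labOf G z₀ a₁ a₂ p v = 1 := (labOf_eq_one_iff G z₀ a₁ a₂ p hQ v).2 hv2
      rw [hv0] at h
      have hw2 := (labOf_eq_one_iff G z₀ a₁ a₂ p hQ w).1 h.symm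
      exact conn_trans (conn_symm hv2) hw2
    · have hw1 : ¬ Conn G z₀ a₁ (p w) := fun hw1 => by
        have := (labOf_eq_zero_iff G z₀ a₁ a₂ p w).2 hw1
        rw [← h] at this
        exact hv1 ((labOf_eq_zero_iff G z₀ a₁ a₂ p v).1 this)
      have hw2 : ¬ Conn G z₀ a₂ (p w) := fun hw2 => by
        have := (labOf_eq_one_iff G z₀ a₁ a₂ p hQ w).2 hw2
        rw [← h] at this
        exact hv2 ((labOf_eq_one_iff G z₀ a₁ a₂ p hQ v).1 this)
      have ev := labOf_of_neither G z₀ a₁ a₂ p hv1 hv2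
      have ew := labOf_of_neither G z₀ a₁ a₂ p hw1 hw2
      have hval : (labOf G z₀ a₁ a₂ p v).val = (labOf G z₀ a₁ a₂ p w).val := by rw [h]
      rw [ev, ew] at hval
      have hr : (least6 fun u => decide (Conn G z₀ (p u) (p v))) =
          (least6 fun u => decide (Conn G z₀ (p u) (p w))) := Fin.ext (by omega)
      have sv := least6_spec (fun u => decide (Conn G z₀ (p u) (p v))) ⟨v, by simp [conn_refl]⟩
      have sw := least6_spec (fun u => decide (Conn G z₀ (p u) (p w))) ⟨w, by simp [conn_refl]⟩
      rw [hr] at sv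
      simp only [decide_eq_true_eq] at sv sw
      exact conn_trans (conn_symm sv) sw
  · intro h
    by_cases hv1 : Conn G z₀ a₁ (p v)
    · rw [(labOf_eq_zero_iff G z₀ a₁ a₂ p v).2 hv1,
        (labOf_eq_zero_iff G z₀ a₁ a₂ p w).2 (conn_trans hv1 h)]
    by_cases hv2 : Conn G z₀ a₂ (p v)
    · rw [(labOf_eq_one_iff G z₀ a₁ a₂ p hQ v).2 hv2,
        (labOf_eq_one_iff G z₀ a₁ a₂ p hQ w).2 (conn_trans hv2 h)]
    · have hw1 : ¬ Conn G z₀ a₁ (p w) := fun hw1 => hv1 (conn_trans hw1 (conn_symm h))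
      have hw2 : ¬ Conn G z₀ a₂ (p w) := fun hw2 => hv2 (conn_trans hw2 (conn_symm h))
      apply Fin.ext
      rw [labOf_of_neither G z₀ a₁ a₂ p hv1 hv2, labOf_of_neither G z₀ a₁ a₂ p hw1 hw2]
      congr 2
      apply least6_congr
      intro u
      simp only [decide_eq_decide]
      exact ⟨fun hu => conn_trans hu h, fun hu => conn_trans hu (conn_symm h)⟩

omit [DecidableEq E] in
/-- The labeling is bounded by `v + 2`. -/
lemma labOf_le (v : Fin 6) : (labOf G z₀ a₁ a₂ p v).val ≤ v.val + 2 := by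
  by_cases h1 : Conn G z₀ a₁ (p v)
  · simp [labOf, h1]
  by_cases h2 : Conn G z₀ a₂ (p v)
  · simp [labOf, h1, h2]
  · rw [labOf_of_neither G z₀ a₁ a₂ p h1 h2]
    have := least6_min (fun u => decide (Conn G z₀ (p u) (p v))) (w := v) (by simp [conn_refl])
    have := Fin.le_def.1 this
    omega

omit [DecidableEq E] in
/-- The labeling is guarded: a label `≥ 2` is carried by the point it names. -/
lemma guard_labOf (hQ : ¬ Conn G z₀ a₁ a₂) : Guard (labOf G z₀ a₁ a₂ p) = true := by
  rw [guard_eq_true_iff]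
  intro v hv
  by_cases h1 : Conn G z₀ a₁ (p v)
  · rw [(labOf_eq_zero_iff G z₀ a₁ a₂ p v).2 h1] at hv; exact absurd hv (by decide)
  by_cases h2 : Conn G z₀ a₂ (p v)
  · rw [(labOf_eq_one_iff G z₀ a₁ a₂ p hQ v).2 h2] at hv; exact absurd hv (by decide)
  · refine ⟨least6 fun u => decide (Conn G z₀ (p u) (p v)), ?_, ?_⟩
    · rw [labOf_of_neither G z₀ a₁ a₂ p h1 h2]; omega
    · rw [labOf_eq_iff G z₀ a₁ a₂ p hQ]
      have := least6_spec (fun u => decide (Conn G z₀ (p u) (p v))) ⟨v, by simp [conn_refl]⟩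
      simpa using this

end Labeling

section Bridge

open Classical

variable {V : Type*} {E : Type*} [DecidableEq E]

/-- The pattern configuration `setOn S (cfg i) z` has the background `setOn S (cfg 0) z`. -/
lemma background_setOn (S : Finset E) (e₁ e₂ e₃ : E) (z : Config E) (i : Fin 8) :
    setOn S (cfg e₁ e₂ e₃ 0) (setOn S (cfg e₁ e₂ e₃ i) z) = setOn S (cfg e₁ e₂ e₃ 0) z := by
  funext e
  by_cases he : e ∈ S
  · rw [setOn_of_mem he, setOn_of_mem he]
  · rw [setOn_of_not_mem he, setOn_of_not_mem he, setOn_of_not_mem he]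

/-- The virtual edge of a pair of distinct terminals is open in the pattern configuration iff its bit is. -/
lemma setOn_cfg_ve (S : Finset E) {e₁ e₂ e₃ : E} (h1 : e₁ ∈ S) (h2 : e₂ ∈ S) (h3 : e₃ ∈ S)
    (h12 : e₁ ≠ e₂) (h13 : e₁ ≠ e₃) (h23 : e₂ ≠ e₃) (z : Config E) (i : Fin 8) {a b' : Fin 3}
    (hab : a ≠ b') : setOn S (cfg e₁ e₂ e₃ i) z (ve e₁ e₂ e₃ a b') = pbit i a b' := by
  have hmem : ve e₁ e₂ e₃ a b' ∈ S := by
    fin_cases a <;> fin_cases b' <;> simp [ve] at hab ⊢ <;> assumption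
  rw [setOn_of_mem hmem]
  fin_cases a <;> fin_cases b' <;> simp [ve, pbit] at hab ⊢
  · exact cfg_s0 e₁ e₂ e₃ i
  · exact cfg_s1 e₁ e₂ e₃ h12 i
  · exact cfg_s0 e₁ e₂ e₃ i
  · exact cfg_s2 e₁ e₂ e₃ h13 h23 i
  · exact cfg_s1 e₁ e₂ e₃ h12 i
  · exact cfg_s2 e₁ e₂ e₃ h13 h23 i

/-- A step is the abstract step. -/
lemma PStep_iff (ends : E → Sym2 V) (S : Finset E) {e₁ e₂ e₃ : E} (h1 : e₁ ∈ S) (h2 : e₂ ∈ S)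
    (h3 : e₃ ∈ S) (h12 : e₁ ≠ e₂) (h13 : e₁ ≠ e₃) (h23 : e₂ ≠ e₃) (o a₁ a₂ a₃ b t₁ t₂ t₃ : V)
    (z : Config E)
    (hQ : ¬ Conn (partEnds ends (↑S) e₁ e₂ e₃ t₁ t₂ t₃) (setOn S (cfg e₁ e₂ e₃ 0) z) a₁ a₂)
    (i : Fin 8) (a b' : Fin 3) :
    PStep ends S e₁ e₂ e₃ t₁ t₂ t₃ (setOn S (cfg e₁ e₂ e₃ i) z) (setOn S (cfg e₁ e₂ e₃ 0) z) a b' ↔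
      pstepB (labOf (partEnds ends (↑S) e₁ e₂ e₃ t₁ t₂ t₃) (setOn S (cfg e₁ e₂ e₃ 0) z) a₁ a₂
        (pt o b a₃ t₁ t₂ t₃)) i a b' = true := by
  unfold PStep pstepB
  rw [Bool.or_eq_true, Bool.and_eq_true, bne_iff_ne, beq_iff_eq, ← pt_tidx o b a₃ t₁ t₂ t₃ a,
    ← pt_tidx o b a₃ t₁ t₂ t₃ b', ← labOf_eq_iff _ _ a₁ a₂ _ hQ]
  constructor
  · rintro (⟨hab, h⟩ | h)
    · exact Or.inl ⟨hab, by rw [← setOn_cfg_ve S h1 h2 h3 h12 h13 h23 z i hab]; exact h⟩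
    · exact Or.inr h
  · rintro (⟨hab, h⟩ | h)
    · exact Or.inl ⟨hab, by rw [setOn_cfg_ve S h1 h2 h3 h12 h13 h23 z i hab]; exact h⟩
    · exact Or.inr h

/-- The relation is the abstract relation. -/
lemma PRel_iff (ends : E → Sym2 V) (S : Finset E) {e₁ e₂ e₃ : E} (h1 : e₁ ∈ S) (h2 : e₂ ∈ S)
    (h3 : e₃ ∈ S) (h12 : e₁ ≠ e₂) (h13 : e₁ ≠ e₃) (h23 : e₂ ≠ e₃) (o a₁ a₂ a₃ b t₁ t₂ t₃ : V)
    (z : Config E)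
    (hQ : ¬ Conn (partEnds ends (↑S) e₁ e₂ e₃ t₁ t₂ t₃) (setOn S (cfg e₁ e₂ e₃ 0) z) a₁ a₂)
    (i : Fin 8) (a b' : Fin 3) :
    PRel ends S e₁ e₂ e₃ t₁ t₂ t₃ (setOn S (cfg e₁ e₂ e₃ i) z) (setOn S (cfg e₁ e₂ e₃ 0) z) a b' ↔
      prelB (labOf (partEnds ends (↑S) e₁ e₂ e₃ t₁ t₂ t₃) (setOn S (cfg e₁ e₂ e₃ 0) z) a₁ a₂
        (pt o b a₃ t₁ t₂ t₃)) i a b' = true := by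
  unfold PRel prelB
  simp only [PStep_iff ends S h1 h2 h3 h12 h13 h23 o a₁ a₂ a₃ b t₁ t₂ t₃ z hQ i, Bool.or_eq_true,
    Bool.and_eq_true, beq_iff_eq]
  constructor
  · rintro (h | h | ⟨c, hc1, hc2⟩)
    · exact Or.inl (Or.inl (Or.inl (Or.inl h)))
    · exact Or.inl (Or.inl (Or.inl (Or.inr h)))
    · fin_cases c
      · exact Or.inl (Or.inl (Or.inr ⟨hc1, hc2⟩))
      · exact Or.inl (Or.inr ⟨hc1, hc2⟩)
      · exact Or.inr ⟨hc1, hc2⟩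
  · intro h
    rcases h with (((h | h) | h) | h) | h
    · exact Or.inl h
    · exact Or.inr (Or.inl h)
    · exact Or.inr (Or.inr ⟨0, h.1, h.2⟩)
    · exact Or.inr (Or.inr ⟨1, h.1, h.2⟩)
    · exact Or.inr (Or.inr ⟨2, h.1, h.2⟩)

/-- Connection to `a₁` in the pattern configuration is the abstract reach of the root `0`. -/
lemma conn_a1_iff (ends : E → Sym2 V) (S : Finset E) {e₁ e₂ e₃ : E} (h1 : e₁ ∈ S) (h2 : e₂ ∈ S)
    (h3 : e₃ ∈ S) (h12 : e₁ ≠ e₂) (h13 : e₁ ≠ e₃) (h23 : e₂ ≠ e₃) (o a₁ a₂ a₃ b t₁ t₂ t₃ : V)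
    (z : Config E)
    (hQ : ¬ Conn (partEnds ends (↑S) e₁ e₂ e₃ t₁ t₂ t₃) (setOn S (cfg e₁ e₂ e₃ 0) z) a₁ a₂)
    (i : Fin 8) (v : Fin 6) :
    Conn (partEnds ends (↑S) e₁ e₂ e₃ t₁ t₂ t₃) (setOn S (cfg e₁ e₂ e₃ i) z) a₁ (pt o b a₃ t₁ t₂ t₃ v) ↔
      reachB (labOf (partEnds ends (↑S) e₁ e₂ e₃ t₁ t₂ t₃) (setOn S (cfg e₁ e₂ e₃ 0) z) a₁ a₂
        (pt o b a₃ t₁ t₂ t₃)) i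
        (labOf (partEnds ends (↑S) e₁ e₂ e₃ t₁ t₂ t₃) (setOn S (cfg e₁ e₂ e₃ 0) z) a₁ a₂
          (pt o b a₃ t₁ t₂ t₃) v) 0 = true := by
  rw [conn_pattern_iff ends S t₁ t₂ t₃ h1 h2 h3 h12 h13 h23, background_setOn S e₁ e₂ e₃ z i]
  unfold reachB
  simp only [Bool.or_eq_true, beq_iff_eq, any3_eq_true_iff, Bool.and_eq_true,
    PRel_iff ends S h1 h2 h3 h12 h13 h23 o a₁ a₂ a₃ b t₁ t₂ t₃ z hQ i,
    ← pt_tidx o b a₃ t₁ t₂ t₃, ← labOf_eq_zero_iff _ _ a₁ a₂ (pt o b a₃ t₁ t₂ t₃),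
    ← labOf_eq_iff _ _ a₁ a₂ _ hQ, and_assoc]

/-- Connection to `a₂` in the pattern configuration is the abstract reach of the root `1`. -/
lemma conn_a2_iff (ends : E → Sym2 V) (S : Finset E) {e₁ e₂ e₃ : E} (h1 : e₁ ∈ S) (h2 : e₂ ∈ S)
    (h3 : e₃ ∈ S) (h12 : e₁ ≠ e₂) (h13 : e₁ ≠ e₃) (h23 : e₂ ≠ e₃) (o a₁ a₂ a₃ b t₁ t₂ t₃ : V)
    (z : Config E)
    (hQ : ¬ Conn (partEnds ends (↑S) e₁ e₂ e₃ t₁ t₂ t₃) (setOn S (cfg e₁ e₂ e₃ 0) z) a₁ a₂)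
    (i : Fin 8) (v : Fin 6) :
    Conn (partEnds ends (↑S) e₁ e₂ e₃ t₁ t₂ t₃) (setOn S (cfg e₁ e₂ e₃ i) z) a₂ (pt o b a₃ t₁ t₂ t₃ v) ↔
      reachB (labOf (partEnds ends (↑S) e₁ e₂ e₃ t₁ t₂ t₃) (setOn S (cfg e₁ e₂ e₃ 0) z) a₁ a₂
        (pt o b a₃ t₁ t₂ t₃)) i
        (labOf (partEnds ends (↑S) e₁ e₂ e₃ t₁ t₂ t₃) (setOn S (cfg e₁ e₂ e₃ 0) z) a₁ a₂
          (pt o b a₃ t₁ t₂ t₃) v) 1 = true := by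
  rw [conn_pattern_iff ends S t₁ t₂ t₃ h1 h2 h3 h12 h13 h23, background_setOn S e₁ e₂ e₃ z i]
  unfold reachB
  simp only [Bool.or_eq_true, beq_iff_eq, any3_eq_true_iff, Bool.and_eq_true,
    PRel_iff ends S h1 h2 h3 h12 h13 h23 o a₁ a₂ a₃ b t₁ t₂ t₃ z hQ i,
    ← pt_tidx o b a₃ t₁ t₂ t₃, ← labOf_eq_one_iff _ _ a₁ a₂ (pt o b a₃ t₁ t₂ t₃) hQ,
    ← labOf_eq_iff _ _ a₁ a₂ _ hQ, and_assoc]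

/-- `a₂ ~ a₁` in the pattern configuration iff `Q` fails abstractly. -/
lemma conn_q_iff (ends : E → Sym2 V) (S : Finset E) {e₁ e₂ e₃ : E} (h1 : e₁ ∈ S) (h2 : e₂ ∈ S)
    (h3 : e₃ ∈ S) (h12 : e₁ ≠ e₂) (h13 : e₁ ≠ e₃) (h23 : e₂ ≠ e₃) (o a₁ a₂ a₃ b t₁ t₂ t₃ : V)
    (z : Config E)
    (hQ : ¬ Conn (partEnds ends (↑S) e₁ e₂ e₃ t₁ t₂ t₃) (setOn S (cfg e₁ e₂ e₃ 0) z) a₁ a₂)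
    (i : Fin 8) :
    Conn (partEnds ends (↑S) e₁ e₂ e₃ t₁ t₂ t₃) (setOn S (cfg e₁ e₂ e₃ i) z) a₂ a₁ ↔
      qFailB (labOf (partEnds ends (↑S) e₁ e₂ e₃ t₁ t₂ t₃) (setOn S (cfg e₁ e₂ e₃ 0) z) a₁ a₂
        (pt o b a₃ t₁ t₂ t₃)) i = true := by
  rw [conn_pattern_iff ends S t₁ t₂ t₃ h1 h2 h3 h12 h13 h23, background_setOn S e₁ e₂ e₃ z i]
  unfold qFailB
  simp only [any3_eq_true_iff, Bool.and_eq_true, beq_iff_eq,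
    PRel_iff ends S h1 h2 h3 h12 h13 h23 o a₁ a₂ a₃ b t₁ t₂ t₃ z hQ i,
    ← pt_tidx o b a₃ t₁ t₂ t₃, and_assoc]
  have hQ' : ¬ Conn (partEnds ends (↑S) e₁ e₂ e₃ t₁ t₂ t₃) (setOn S (cfg e₁ e₂ e₃ 0) z) a₂ a₁ :=
    fun h => hQ (conn_symm h)
  constructor
  · rintro (h | ⟨a, b', hr, ha, hb⟩)
    · exact absurd h hQ'
    · exact ⟨a, b', hr, (labOf_eq_one_iff _ _ a₁ a₂ _ hQ _).2 ha,
        (labOf_eq_zero_iff _ _ a₁ a₂ _ _).2 (conn_symm hb)⟩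
  · rintro ⟨a, b', hr, ha, hb⟩
    exact Or.inr ⟨a, b', hr, (labOf_eq_one_iff _ _ a₁ a₂ _ hQ _).1 ha,
      conn_symm ((labOf_eq_zero_iff _ _ a₁ a₂ _ _).1 hb)⟩

/-- **THE STATE OF A PATTERN CONFIGURATION IS THE ABSTRACT STATE OF THE LABELING.** -/
theorem st_eq_stAbs (ends : E → Sym2 V) (S : Finset E) {e₁ e₂ e₃ : E} (h1 : e₁ ∈ S) (h2 : e₂ ∈ S)
    (h3 : e₃ ∈ S) (h12 : e₁ ≠ e₂) (h13 : e₁ ≠ e₃) (h23 : e₂ ≠ e₃) (o a₁ a₂ a₃ b t₁ t₂ t₃ : V)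
    (z : Config E)
    (hQ : ¬ Conn (partEnds ends (↑S) e₁ e₂ e₃ t₁ t₂ t₃) (setOn S (cfg e₁ e₂ e₃ 0) z) a₁ a₂)
    (i : Fin 8) :
    st (partEnds ends (↑S) e₁ e₂ e₃ t₁ t₂ t₃) o a₁ a₂ a₃ b (setOn S (cfg e₁ e₂ e₃ i) z) =
      stAbs (labOf (partEnds ends (↑S) e₁ e₂ e₃ t₁ t₂ t₃) (setOn S (cfg e₁ e₂ e₃ 0) z) a₁ a₂
        (pt o b a₃ t₁ t₂ t₃)) i := by
  unfold st stAbs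
  have c1 := conn_a1_iff ends S h1 h2 h3 h12 h13 h23 o a₁ a₂ a₃ b t₁ t₂ t₃ z hQ i
  have c2 := conn_a2_iff ends S h1 h2 h3 h12 h13 h23 o a₁ a₂ a₃ b t₁ t₂ t₃ z hQ i
  have cq := conn_q_iff ends S h1 h2 h3 h12 h13 h23 o a₁ a₂ a₃ b t₁ t₂ t₃ z hQ i
  have e0 : pt o b a₃ t₁ t₂ t₃ 0 = o := rfl
  have e1 : pt o b a₃ t₁ t₂ t₃ 1 = b := rfl
  have e2 : pt o b a₃ t₁ t₂ t₃ 2 = a₃ := rfl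
  have c10 := c1 0; have c20 := c2 0; have c11 := c1 1; have c21 := c2 1
  have c12 := c1 2; have c22 := c2 2
  rw [e0] at c10 c20
  rw [e1] at c11 c21
  rw [e2] at c12 c22
  refine Prod.ext ?_ (Prod.ext ?_ (Prod.ext ?_ (Prod.ext ?_ (Prod.ext ?_ (Prod.ext ?_ ?_)))))
  · exact Bool.eq_iff_iff.2 (by rw [decide_eq_true_iff]; exact cq)
  · exact Bool.eq_iff_iff.2 (by rw [decide_eq_true_iff]; exact c10)
  · exact Bool.eq_iff_iff.2 (by rw [decide_eq_true_iff]; exact c20)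
  · exact Bool.eq_iff_iff.2 (by rw [decide_eq_true_iff]; exact c11)
  · exact Bool.eq_iff_iff.2 (by rw [decide_eq_true_iff]; exact c21)
  · exact Bool.eq_iff_iff.2 (by rw [decide_eq_true_iff]; exact c12)
  · exact Bool.eq_iff_iff.2 (by rw [decide_eq_true_iff]; exact c22)

end Bridge

end Part

end Summit.Ventures.PercRepro2
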